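import Summits.CriticalPhenomena.Ising3DConformalLimit.Theses.ClusterRigidity
import Summits.CriticalPhenomena.Ising3DConformalLimit.Theorems.HyperoctahedralRPExistsScaleCovariantLimitCompactnessItemMapsDoubling
import Summits.CriticalPhenomena.Ising3DConformalLimit.Theorems.HyperoctahedralRPExistsScaleCovariantLimitGeomPairLimitPos
import Literature.Probability.LatticeModels.AxisSpectralRepresentationProofs
import HarnessLib.Audit.Check

/-!
# Birth skeleton for crux `UniformRegularity` (stmt-CriticalPhenomena-4658), route `ClusterRigidity`

Crux (Reg), rank 3 of `route-CriticalPhenomena-ClusterRigidity` (sub-problem `Ising3DConformalLimit`; the decl is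
shared verbatim with routes `MonotoneRG`, `MirrorHoelderCompactness`, `SynchronousCoupling`): for the
SELF-NORMALISED rescaled critical correlators `F_δ(n,x) = ρ★(δ)ⁿ ⟨∏ σ_{⌊xᵢ/δ⌋}⟩⁺_{β_c(3)}`,
`ρ★(δ) = ⟨σ₀σ_{⌊1/δ⌋e₀}⟩^{-1/2}`, on every compact `K ⊆ NonCoincident 3 n`: (a) a uniform bound, (b) uniform
asymptotic equicontinuity, (c) at `n = 2` a uniform positive lower bound, all for `δ < δ₀(K)`.

## What the tree already knows (and why the cut is made where it is)

By LANDED theorems the crux is ONE scalar lattice inequality: `uniformRegularity_iff_doubling`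
(`Theorems/…CompactnessItemMapsDoubling`, p120504) — `UniformRegularity ⟺ TwoPointDoubling` (item 6150:
`∃ κ > 0, ∀ n ≥ 1, κ·g(n) ≤ g(2n)`, `g(n) = ⟨σ₀σ_{n e₀}⟩⁺_{β_c(3)} = criticalTwoPoint 3 (Pi.single 0 n)`), the
n-point transfer ((a) by Newman–Aizenman Gaussian domination + `m*(β_c) = 0`, (c) and the angular comparison by
Messager–Miracle-Solé, (b) by the mirror-Hölder one-point-move modulus) being proved (`rescaledBounds_proof`,
`separableHoelder_proof`, `pairMoveHoelder_of_doubling`, `orbitPrecompact_of_pairRegularity`). Every NATIVE piece of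
the crux ((a), (b) or (c), already at `n = 2`) is therefore equivalent to the whole crux, and so are the landed
reformulations of 6150 (dyadic / eventual doubling, log-free axial gradient rate `g(k) − g(k+1) ≤ A g(k)/k`, axis ratio
rate, `OrbitPrecompact` 5955, `PairRegularity`): none of them may serve as a stub (costume). The sibling birth
skeleton of 6150 (`Cruxes/TwoPointDoubling/Lines/birth.lean`) cuts the doubling inequality by REGIME (DC–Panis
lean/fat scales). This skeleton cuts it by REPRESENTATION.

## The line: doubling in space ⟸ doubling of the Källén–Lehmann weight at the top of the spectrum

By reflection positivity the critical axis two-point function on `ℤ³` is a Hausdorff moment sequence — LANDED,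
sorry-free: `AizenmanDuminilCopin2021_prop_8_6_holds.hausdorffMoment` (ADC21 App. A.3 Prop. 8.6 = Prop. 5.3) with
`m*(β_c) = 0` (`spontaneousMagnetization_criticalBeta_eq_zero_holds`) and `β_c > 0` (`criticalBeta_pos_holds`):

  `g(n) = ∫_{[0,1]} λⁿ dν(λ)`  for all `n : ℕ`, `ν` a finite positive measure carried by `[0,1]`

(`ν` = the spectral measure of the two-plane transfer operator `T = e^{-H}` in the vector `σ̂₀Ω`; `λ = e^{-E}`).
Write `m(t) := ν([1 − t, 1])`, the spectral weight within energy `≲ t` of the ground state — a NONDECREASING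
function of ONE variable that carries the whole axis two-point function (`g(n) = ∫₀¹ n(1−t)^{n−1} m(t) dt`).

* `stub_spectralTopDoubling` (OPEN — the load-bearing stub, the crux TRANSFERRED): `m` is a doubling function at
  `0⁺`: `∃ κ > 0, t₀ ∈ (0,1], ∀ t ∈ (0,t₀], κ·m(t) ≤ m(t/2)`. Why plausibly true: in the expected world
  `g(n) ~ c·n^{-(1+η)}` is regularly varying, hence (Karamata's Tauberian theorem for power moments / Laplace
  transforms of monotone densities) `m(t) ~ c'·t^{1+η}` is regularly varying at `0` and doubling; it is implied by
  the two-point pure power law (item 0634) and by the dyadic scaling law of route `ThresholdDilation`. Why it might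
  fail / what it needs: Källén–Lehmann positivity ALONE does not give it — the completely monotone crossover
  profiles `c n^{-3/2} + C e^{-n/N}/n` (card crossover-witness-no-doubling; refuter Negative
  `ZoomMonotone/Negative/DoublingWitness`) have spectral functions `c t^{3/2} + C (t − 1/N)₊` whose doubling constant
  degrades polynomially in `N` (worst moment ratio `g(2n)/g(n)` ≈ `N^{-1/4}` for fixed `c, C`, ≈ `N^{-1/2}` for
  `C ∼ √N`, attained at `n ≈ (N/4) log N`; numerics in the planner folder `tmp/sanity_witness.py`); an
  Ising-specific SPECTRAL input is required (the momentum-resolved infrared bound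
  `∫ (1+λ)(1−λ)^{-1} dν_{p_⊥} ≤ C |p_⊥|^{-2}` of ADC21 Prop. 8.6 with `v` a transverse plane wave, locality / FKG of
  the transfer operator in the time direction, or a threshold-dilation implementer as in route `ThresholdDilation`
  items (R), (V)). WHY EASIER than (D): the object is a monotone function localised at the bottom of the energy
  spectrum, where variational (min–max with block-spin trial states), Tauberian (Karamata–de Haan) and
  operator-theoretic (Mourre / conjugate-operator) tools act directly, and positivity is built into the object
  instead of being an inequality to rediscover at each scale.
* `stub_momentDoubling_of_spectralTopDoubling` (PROVABLE NOW, size M, pure real analysis — the ABELIAN transfer):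
  for ANY finite positive measure `ν` on `[0,1]` whose moments obey a polynomial lower bound `∫ λⁿ dν ≥ c/n²`
  (`n ≥ 1`), top-doubling of `ν` implies doubling of the moment sequence: `∃ κ' > 0, ∀ n ≥ 1,
  κ'·∫ λⁿ dν ≤ ∫ λ^{2n} dν`. Proof sketch (for the prover): with `t = A/n ≤ t₀`,
  `∫ λ^{2n} dν ≥ (1 − A/(2n))^{2n} m(A/(2n)) ≥ κ e^{-2A} m(A/n)`; dyadic shells `[1 − 2^{j+1}t, 1 − 2^j t)` below
  `t₀` carry mass `≤ κ^{-(j+1)} m(t)` and weight `≤ e^{-2^j A}`, so for `A ≥ A₀(κ)` they contribute `≤ m(A/n)`; the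
  part of `[0, 1 − t₀/2)` contributes `≤ ν(ℝ)(1 − t₀/2)ⁿ`, exponentially small, while `m(A/n) ≥ c/(4n²)` for large
  `n` by the moment lower bound; hence `∫ λⁿ dν ≤ 3 m(A/n)` and doubling with `κ' = κ e^{-2A}/3` for `n ≥ n₀`, the
  finitely many `n < n₀` by `∫ λ^{2n} dν ≥ c/(4n²)` and `∫ λⁿ dν ≤ ν(ℝ)`.
* `UniformRegularity_of` (REAL PROOF, this file): take `ν` from the landed Hausdorff representation, `κ, t₀` from
  stub 1, the moment lower bound from the landed Simon–Lieb axis bound `c/m² ≤ g(m)`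
  (`TwoHierarchies.criticalTwoPoint_axis_sq_lower`), doubling of the moments from stub 2, read it back on the
  lattice as item 6150 `TwoPointDoubling`, and conclude by the landed `ItemMaps.uniformRegularity_of_doubling`
  (6150 ⟹ 4658 in the `MonotoneRG` namespace, whose decl is VERBATIM the `ClusterRigidity` one: `Iff.rfl`).

Neither stub is cheaply the crux or the summit: stub 1 speaks about a measure `ν`, not about correlators, and
reaches the crux only through stub 2 + the Hausdorff representation + the 6150 ⟹ 4658 map; stub 2 is a
measure-theoretic lemma true for every finite measure on `[0,1]` (it does not mention the Ising model). The
converse Tauberian direction (doubling of `g` ⟹ top-doubling of `ν`) is plausible (de Haan theory for monotone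
`m`) but is NOT claimed or used. BC3 probes (`stub → UniformRegularity`, `stub → Ising3DConformalLimit` by
`first | exact? | simpa | aesop`, with and without the landed item-map modules imported) are recorded in the
planner folder (`bc/probe_P{1..4}.lean`, `bc/probe_Q{1..6}.lean`, `bc/probe_{P3,Q4}s.lean`) and in `Lines/birth.md`
on the crux: all 10 chained + 8 single-tactic probes fail (rc 1).

Disproof used: none on file (`ledger crux ls stmt-CriticalPhenomena-4658`: no workfiles before this one; no
`Theorems/UniformRegularity/Negative/`). Honoured instead: the refuter Negative lemmas of the sibling cruxes —
`ZoomMonotone/Negative/DoublingWitness` + `AxisStructureInsufficient` (the axis-facts package incl. log-convexity and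
the IR window does not decide doubling): stub 1 is NOT an axis-facts consequence and says so; and
`ExistsScaleCovariantLimit/Negative/TightnessUniqueness` (4658/5955 is exactly the tightness half). Negatives index
(`ledger negatives --problem CriticalPhenomena`, 2026-08-17): 11 refuted statements, all in CardyFormulaZ2 /
PercolationContinuityZ3 / SAWScalingLimit — none concerns `criticalTwoPoint 3`, Hausdorff moment measures or doubling.

References: M. Aizenman, H. Duminil-Copin, Ann. of Math. 194 (2021) = arXiv:1912.07973, Prop. 5.3, Remark 5.10,
§5.6, App. A.3 Prop. 8.6 [AizenmanDuminilCopinAnnals2021]; H. Duminil-Copin, R. Panis, arXiv:2404.05700 Thm 1.5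
[DuminilcopinPanis2025]; J. Glimm, A. Jaffe, *Quantum Physics* (1987) §6 (Källén–Lehmann) [GlimmJaffe1987];
W. Feller, *An Introduction to Probability Theory* II (1971), XIII.5 (Karamata's Tauberian theorem) [Feller1971];
N. H. Bingham, C. M. Goldie, J. L. Teugels, *Regular Variation* (1987), §1.7 and Thm 1.7.1 [BinghamGoldieTeugels1987];
B. Simon, CMP 77 (1980) Thm 1 [Simon1980].
-/

noncomputable section

namespace Summit.CriticalPhenomena.Ising3DConformalLimit.Cruxes.UniformRegularity.Birth

open scoped BigOperators Topology Classical ENNReal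
open Filter Set Function MeasureTheory
open Literature.Probability.LatticeModels

/-! ## The two registered stubs (signatures fully qualified, over importable vocabulary only) -/

/-- **STUB 1 · `stub_spectralTopDoubling` (OPEN — load-bearing; the crux transferred to the spectral side).**
Every finite positive measure `ν` on `[0,1]` whose power moments are the critical axis two-point function of the
nearest-neighbour Ising model on `ℤ³`, `⟨σ₀σ_{n e₀}⟩⁺_{β_c(3)} = ∫ λⁿ dν(λ)` for all `n : ℕ` (such a `ν` EXISTS and is
unique: the Källén–Lehmann / Hausdorff moment measure, `AizenmanDuminilCopin2021_prop_8_6_holds.hausdorffMoment`),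
is DOUBLING AT THE TOP OF THE SPECTRUM: `∃ κ > 0, t₀ ∈ (0,1], ∀ t ∈ (0,t₀], κ·ν([1−t,1]) ≤ ν([1−t/2,1])`.
True in the expected world (`g(n) ~ c n^{-(1+η)}` ⟹ `ν([1−t,1]) ~ c' t^{1+η}` by Karamata); NOT a consequence of
spectral positivity + the IR window (crossover witnesses); needs Ising-specific spectral input (momentum-resolved
infrared bound, locality of the transfer operator, or a threshold-dilation implementer).
[AizenmanDuminilCopinAnnals2021 Prop. 5.3, Rem. 5.10, App. A.3 Prop. 8.6; Feller1971 XIII.5; BinghamGoldieTeugels1987 Thm 1.7.1] -/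
theorem stub_spectralTopDoubling :
    ∀ ν : MeasureTheory.Measure ℝ, MeasureTheory.IsFiniteMeasure ν → ν (Set.Icc (0 : ℝ) 1)ᶜ = 0 →
      (∀ n : ℕ, Literature.Probability.LatticeModels.criticalTwoPoint 3 (Pi.single 0 (n : ℤ)) = ∫ t, t ^ n ∂ν) →
      ∃ κ t₀ : ℝ, 0 < κ ∧ 0 < t₀ ∧ t₀ ≤ 1 ∧ ∀ t ∈ Set.Ioc (0 : ℝ) t₀,
        κ * ν.real (Set.Icc (1 - t) 1) ≤ ν.real (Set.Icc (1 - t / 2) 1) := by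
  sorry

/-- **STUB 2 · `stub_momentDoubling_of_spectralTopDoubling` (PROVABLE NOW, M — the Abelian transfer).**
For every finite positive measure `ν` on `[0,1]` with a polynomial lower bound on its moments,
`c/n² ≤ ∫ λⁿ dν` for `n ≥ 1`, doubling of `ν` at the top of the spectrum (`κ·ν([1−t,1]) ≤ ν([1−t/2,1])` for
`0 < t ≤ t₀`) implies doubling of the moment sequence: `∃ κ' > 0, ∀ n ≥ 1, κ'·∫ λⁿ dν ≤ ∫ λ^{2n} dν`.
(Choose `t = A/n`: the top window gives `∫ λ^{2n} dν ≥ κ e^{-2A} ν([1−A/n,1])`; dyadic shells below `t₀` are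
controlled by iterated doubling against the weights `e^{-2^j A}`, the bulk `[0,1−t₀/2)` is exponentially small
against the polynomial lower bound; small `n` by positivity.) Pure measure theory / real analysis; it does not
mention the Ising model. [Feller1971 XIII.5 (Abelian half of the Tauberian correspondence); BinghamGoldieTeugels1987 §1.7] -/
theorem stub_momentDoubling_of_spectralTopDoubling :
    ∀ ν : MeasureTheory.Measure ℝ, MeasureTheory.IsFiniteMeasure ν → ν (Set.Icc (0 : ℝ) 1)ᶜ = 0 →
      (∃ c : ℝ, 0 < c ∧ ∀ n : ℕ, 1 ≤ n → c / (n : ℝ) ^ 2 ≤ ∫ t, t ^ n ∂ν) →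
      (∃ κ t₀ : ℝ, 0 < κ ∧ 0 < t₀ ∧ t₀ ≤ 1 ∧ ∀ t ∈ Set.Ioc (0 : ℝ) t₀,
        κ * ν.real (Set.Icc (1 - t) 1) ≤ ν.real (Set.Icc (1 - t / 2) 1)) →
      ∃ κ' : ℝ, 0 < κ' ∧ ∀ n : ℕ, 1 ≤ n → κ' * (∫ t, t ^ n ∂ν) ≤ ∫ t, t ^ (2 * n) ∂ν := by
  sorry

/-! ## Names for the statements (hypotheses of the composition)

The layer-invariant audit admits, as hypotheses of the theorem that concludes the crux, only registered
obligations or the declared stubs BY NAME; `Statement.stub_x` is the statement of `stub_x` (its `type_of%`). -/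

namespace Statement

/-- Statement of `stub_spectralTopDoubling`. -/
abbrev stub_spectralTopDoubling : Prop := type_of% Birth.stub_spectralTopDoubling
/-- Statement of `stub_momentDoubling_of_spectralTopDoubling`. -/
abbrev stub_momentDoubling_of_spectralTopDoubling : Prop :=
  type_of% Birth.stub_momentDoubling_of_spectralTopDoubling

end Statement

/-! ## Landed inputs used by the composition (proved, no sorry) -/

/-- The crux of route `ClusterRigidity` is VERBATIM the `UniformRegularity` decl of route `MonotoneRG` (the shared
item stmt-CriticalPhenomena-4658; the gate writes the same text in both route files). [folklore] -/
theorem monotoneRG_uniformRegularity_iff :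
    Summit.CriticalPhenomena.Ising3DConformalLimit.Theses.MonotoneRG.UniformRegularity ↔
      Summit.CriticalPhenomena.Ising3DConformalLimit.Theses.ClusterRigidity.UniformRegularity :=
  Iff.rfl

/-- **The Källén–Lehmann / Hausdorff moment measure of the critical axis two-point function on `ℤ³` EXISTS**
(landed: ADC21 Prop. 8.6 `AizenmanDuminilCopin2021_prop_8_6_holds`, `m*(β_c) = 0`, `β_c > 0`): a finite positive
measure `ν` on `[0,1]` with `⟨σ₀σ_{n e₀}⟩⁺_{β_c(3)} = ∫ λⁿ dν` for all `n`. So stub 1 is not vacuous.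
[AizenmanDuminilCopinAnnals2021 App. A.3 Prop. 8.6] -/
theorem exists_hausdorffMeasure :
    ∃ ν : MeasureTheory.Measure ℝ, MeasureTheory.IsFiniteMeasure ν ∧ ν (Set.Icc (0 : ℝ) 1)ᶜ = 0 ∧
      ∀ n : ℕ, criticalTwoPoint 3 (Pi.single 0 (n : ℤ)) = ∫ t, t ^ n ∂ν := by
  have hβ : 0 < criticalBeta (2 + 1) := criticalBeta_pos_holds (d := 2 + 1) (by norm_num)
  have hm : spontaneousMagnetization (2 + 1) (criticalBeta (2 + 1)) = 0 :=
    spontaneousMagnetization_criticalBeta_eq_zero_holds (d := 2 + 1) (by norm_num)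
  obtain ⟨ν, hfin, hsupp, hrep⟩ :=
    AizenmanDuminilCopin2021_prop_8_6_holds.hausdorffMoment (d' := 2) hβ hm 0
  exact ⟨ν, hfin, hsupp, fun n => hrep n⟩

/-- The moment sequence of the Hausdorff measure inherits the Simon–Lieb lower bound `c/m² ≤ g(m)` (landed,
`TwoHierarchies.criticalTwoPoint_axis_sq_lower`). [Simon1980 Thm 1] -/
theorem moments_lower {ν : MeasureTheory.Measure ℝ}
    (hrep : ∀ n : ℕ, criticalTwoPoint 3 (Pi.single 0 (n : ℤ)) = ∫ t, t ^ n ∂ν) :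
    ∃ c : ℝ, 0 < c ∧ ∀ n : ℕ, 1 ≤ n → c / (n : ℝ) ^ 2 ≤ ∫ t, t ^ n ∂ν := by
  obtain ⟨c, hc, hlow⟩ :=
    Summit.CriticalPhenomena.Ising3DConformalLimit.Cruxes.ExistsScaleCovariantLimit.TwoHierarchies.criticalTwoPoint_axis_sq_lower
  exact ⟨c, hc, fun n hn => by rw [← hrep n]; exact hlow n hn⟩

/-- Reading a doubling moment sequence back on the lattice: item 6150 `TwoPointDoubling`. [folklore] -/
theorem twoPointDoubling_of_moments {ν : MeasureTheory.Measure ℝ}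
    (hrep : ∀ n : ℕ, criticalTwoPoint 3 (Pi.single 0 (n : ℤ)) = ∫ t, t ^ n ∂ν)
    {κ' : ℝ} (hκ' : 0 < κ') (hd : ∀ n : ℕ, 1 ≤ n → κ' * (∫ t, t ^ n ∂ν) ≤ ∫ t, t ^ (2 * n) ∂ν) :
    Summit.CriticalPhenomena.Ising3DConformalLimit.Theses.MirrorHoelderCompactness.TwoPointDoubling := by
  refine ⟨κ', hκ', fun n hn => ?_⟩
  have h := hd n hn
  rw [← hrep n, ← hrep (2 * n)] at h
  have hcast : ((2 * n : ℕ) : ℤ) = 2 * (n : ℤ) := by push_cast; ring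
  rw [hcast] at h
  exact h

/-! ## The composition (kernel-checked, no sorry): the two stubs give the crux BY NAME -/

/-- **`UniformRegularity` from the stubs.** Take the Hausdorff measure `ν` of the critical axis two-point function
(landed), its top-of-spectrum doubling (stub 1), the Simon–Lieb lower bound on its moments (landed), doubling of the
moment sequence (stub 2) = item 6150 `TwoPointDoubling` read on the lattice, and the landed map 6150 ⟹ 4658
(`ItemMaps.uniformRegularity_of_doubling`, `MonotoneRG` namespace, verbatim the `ClusterRigidity` decl). -/
theorem UniformRegularity_of (h₁ : Statement.stub_spectralTopDoubling)
    (h₂ : Statement.stub_momentDoubling_of_spectralTopDoubling) :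
    Summit.CriticalPhenomena.Ising3DConformalLimit.Theses.ClusterRigidity.UniformRegularity := by
  obtain ⟨ν, hfin, hsupp, hrep⟩ := exists_hausdorffMeasure
  -- stub 1: top-of-spectrum doubling of the Källén–Lehmann measure
  obtain ⟨κ, t₀, hκ, ht₀, ht₁, hdbl⟩ := h₁ ν hfin hsupp hrep
  -- stub 2: doubling of the moment sequence (lower bound on moments from Simon–Lieb)
  obtain ⟨κ', hκ', hd⟩ := h₂ ν hfin hsupp (moments_lower hrep) ⟨κ, t₀, hκ, ht₀, ht₁, hdbl⟩
  -- item 6150, then the landed item map 6150 ⟹ 4658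
  exact monotoneRG_uniformRegularity_iff.1
    (Summit.CriticalPhenomena.Ising3DConformalLimit.Cruxes.ExistsScaleCovariantLimit.TwoHierarchies.ItemMaps.uniformRegularity_of_doubling
      (twoPointDoubling_of_moments hrep hκ' hd))

end Summit.CriticalPhenomena.Ising3DConformalLimit.Cruxes.UniformRegularity.Birth

end
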